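import Summits.AtomisticToContinuum.HydrodynamicLimit.Theorems.AnnealedZeroHorizonMeanFluxClosureIdealEnergyCurrentClosure
import Summits.AtomisticToContinuum.HydrodynamicLimit.Theorems.AnnealedZeroHorizonMeanFluxClosureIdealEnergyCurrentClosureB
import Summits.AtomisticToContinuum.HydrodynamicLimit.Theorems.AnnealedZeroHorizonMeanFluxClosureDeviatoricStressClosureC
import HarnessLib

/-!
# Crux `MeanFluxClosure` (stmt-AtomisticToContinuum-9256), line `registered` — stub KE-b
# (ideal energy-current / heat-flux closure), part 3: at equilibrium the mean vanishes for every `N`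

Support file (`--supports stmt-AtomisticToContinuum-9256`) for the stub `stub_idealEnergyCurrentClosure`
(KE-b), continuing parts 1–2. For CONSTANT profiles `a₀ ≡ a > 0`, `u₀ ≡ u`, `θ₀ ≡ θ > 0` (`σ ≤ 1/2`) the
stub's functional `D` (with `Φ` for `Φ N`) has mean exactly `0` under the local Gibbs law, for every `N`,
flow, window, smooth `ψ` and continuous probability kernel `k ≥ 0`
(`stub_idealEnergyCurrentClosure_equilibrium`, registered sub-goal): time Fubini + stationarity
(`integral_window_flow_eq_const_moment`, the moment-dominated variant of KS-b's
`DeviatoricStressClosure.integral_window_flow_eq_const`), translation invariance of the means of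
shift-covariant observables (`DeviatoricStressClosure.integral_translate_eq`), a spatial Fubini under
moment domination (`integral_integral_swap_of_le_moment`) and `∫_{𝕋³} ∂_iψ = 0`
(`integral_covariantVectorPairing_eq_zero`, `integral_currentObservable_eq_zero_const`,
`integral_idealCurrentObservable_eq_zero_const`). So the stub holds trivially along the equilibrium
sequence; its content is the NON-equilibrium vanishing in mean of the scale-`ℓ` heat flux and of the
velocity-weighted peculiar-stress deviator (`stub_idealEnergyCurrentClosure_identity`).
No definitions. Reference: Spohn (1991), Part I §2.3.
-/

noncomputable section

namespace Summit.AtomisticToContinuum.HydrodynamicLimit.Theorems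

open scoped BigOperators ENNReal Topology InnerProductSpace
open MeasureTheory Set Filter
open Literature.Analysis.FluidPDE Literature.Analysis.FunctionSpaces
open Literature.MathematicalPhysics.KineticTheory

namespace IdealEnergyCurrentClosure

open DeviatoricStressClosure
open LocalSecondLawNegative (flowReg flowReg_of_mem measurable_flowReg)

/-! ### Equilibrium tools under moment domination -/

/-- **Time Fubini + stationarity at equilibrium, moment-dominated observables.** For the
constant-profile local Gibbs law (`σ ≤ 1/2`, `a, θ > 0`; flow invariant) and a measurable observable `G`
with `|G(w)| ≤ K M(w)`, `M(w) = Σ_b‖v_b‖² + (Σ_b‖v_b‖²)²` (conserved),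
`E ∫_{t₁}^{t₂} G(Φ_s z) ds = (t₂ − t₁) E G` (Fubini over `(z, s)` through the jointly measurable
modification `flowReg` of the flow). [folklore] -/
theorem integral_window_flow_eq_const_moment {σ : ℝ} (hσ : σ ≤ 1 / 2) {a θ : ℝ} (ha : 0 < a)
    (hθ : 0 < θ) (u : V3) {N : ℕ} (Φ : HardSphereFlow (Torus.geometry (Fin 3)) (hsDiameter σ N) (N + 1))
    {G : Config (N + 1) (Fin 3) T3 → ℝ} (hGm : Measurable G) {K : ℝ}
    (hGle : ∀ w, |G w| ≤ K * ((∑ b, ‖(w b).2‖ ^ 2) + (∑ b, ‖(w b).2‖ ^ 2) ^ 2)) {t₁ t₂ : ℝ}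
    (h₁₂ : t₁ ≤ t₂) :
    ∫ z, (∫ s in t₁..t₂, G (Φ.flow s z)) ∂(localGibbsLaw σ (fun _ => a) (fun _ => u) (fun _ => θ) N Φ) =
      (t₂ - t₁) * ∫ z, G z ∂(localGibbsLaw σ (fun _ => a) (fun _ => u) (fun _ => θ) N Φ) := by
  set μ := localGibbsLaw σ (fun _ => a) (fun _ => u) (fun _ => θ) N Φ with hμ
  haveI hprob : IsProbabilityMeasure μ := isProbabilityMeasure_localGibbsLaw continuous_const
    continuous_const continuous_const (fun _ => ha) (fun _ => hθ) hσ N Φ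
  have hgood : ∀ᵐ z ∂μ, z ∈ Φ.good := (ae_mem_good_localGibbsLaw σ _ _ _ N Φ).1
  have hMint := integrable_moment hσ (u₀ := fun _ => u) continuous_const continuous_const continuous_const
    (fun _ => ha) (fun _ => hθ) N Φ
  -- the jointly measurable modification of `(z, s) ↦ G (Φ_s z)`
  set H : Config (N + 1) (Fin 3) T3 × ℝ → ℝ := fun p => G (flowReg Φ p) with hH
  have hHm : Measurable H := hGm.comp (measurable_flowReg Φ)
  have hHle : ∀ p, ‖H p‖ ≤ K * ((∑ b, ‖(p.1 b).2‖ ^ 2) + (∑ b, ‖(p.1 b).2‖ ^ 2) ^ 2) := by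
    rintro ⟨z, s⟩
    rw [Real.norm_eq_abs, hH]
    dsimp only
    by_cases hz : z ∈ Φ.good
    · rw [flowReg_of_mem Φ hz s]
      have h := hGle (Φ.flow s z)
      rwa [sum_norm_sq_vel_flow Φ hz s] at h
    · have h : flowReg Φ (z, s) = z := by simp [flowReg, hz]
      rw [h]
      exact hGle z
  have hHint : Integrable H (μ.prod (volume.restrict (Ioc t₁ t₂))) :=
    Integrable.mono' ((hMint.const_mul K).comp_fst _) hHm.aestronglyMeasurable (ae_of_all _ hHle)
  have h1 : (fun z => ∫ s in t₁..t₂, G (Φ.flow s z)) =ᵐ[μ] fun z => ∫ s in Ioc t₁ t₂, H (z, s) := by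
    filter_upwards [hgood] with z hz
    rw [intervalIntegral.integral_of_le h₁₂]
    refine integral_congr_ae (ae_of_all _ fun s => ?_)
    simp only [hH, flowReg_of_mem Φ hz]
  have h3 : ∀ s, ∫ z, H (z, s) ∂μ = ∫ z, G z ∂μ := fun s => by
    have hae : (fun z => H (z, s)) =ᵐ[μ] fun z => G (Φ.flow s z) := by
      filter_upwards [hgood] with z hz
      simp only [hH, flowReg_of_mem Φ hz]
    rw [integral_congr_ae hae]
    exact integral_comp_flow_localGibbsLaw_const σ a θ u N Φ s hGm.aestronglyMeasurable
  rw [integral_congr_ae h1, integral_integral_swap (f := fun z s => H (z, s)) hHint]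
  simp_rw [h3]
  rw [setIntegral_const, smul_eq_mul, Real.volume_real_Ioc, max_eq_left (sub_nonneg.2 h₁₂)]

/-- **Spatial Fubini** under the local Gibbs law (`σ ≤ 1/2`, continuous profiles) for a jointly measurable
integrand dominated by the moment functional `M(w)` uniformly in the base point. [folklore] -/
theorem integral_integral_swap_of_le_moment {σ : ℝ} (hσ : σ ≤ 1 / 2) {a₀ θ₀ : T3 → ℝ} {u₀ : T3 → V3}
    (ha : Continuous a₀) (hθ : Continuous θ₀) (hu : Continuous u₀) (ha0 : ∀ x, 0 < a₀ x)
    (hθ0 : ∀ x, 0 < θ₀ x) {N : ℕ} (Φ : HardSphereFlow (Torus.geometry (Fin 3)) (hsDiameter σ N) (N + 1))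
    (F : Config (N + 1) (Fin 3) T3 → T3 → ℝ) (hFm : Measurable fun p : Config (N + 1) (Fin 3) T3 × T3 => F p.1 p.2)
    {K : ℝ} (hFle : ∀ w x, |F w x| ≤ K * ((∑ b, ‖(w b).2‖ ^ 2) + (∑ b, ‖(w b).2‖ ^ 2) ^ 2)) :
    (∀ x, Integrable (fun w => F w x) (localGibbsLaw σ a₀ u₀ θ₀ N Φ)) ∧
      (∫ w, (∫ x, F w x) ∂(localGibbsLaw σ a₀ u₀ θ₀ N Φ)) = ∫ x, (∫ w, F w x ∂(localGibbsLaw σ a₀ u₀ θ₀ N Φ)) := by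
  haveI := isProbabilityMeasure_localGibbsLaw ha hθ hu ha0 hθ0 hσ N Φ
  have hMint := integrable_moment hσ ha hθ hu ha0 hθ0 N Φ
  have hint : Integrable (Function.uncurry F) ((localGibbsLaw σ a₀ u₀ θ₀ N Φ).prod volume) :=
    Integrable.mono' ((hMint.const_mul K).comp_fst volume) hFm.aestronglyMeasurable
      (ae_of_all _ fun p => by
        rw [Real.norm_eq_abs]
        exact hFle p.1 p.2)
  refine ⟨fun x => ?_, integral_integral_swap hint⟩
  exact Integrable.mono' (hMint.const_mul K) (hFm.comp (measurable_id.prodMk measurable_const)).aestronglyMeasurable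
    (ae_of_all _ fun w => by
      rw [Real.norm_eq_abs]
      exact hFle w x)

/-- **Covariant vector pairings with `∇ψ` have mean zero at equilibrium.** For the constant-profile local
Gibbs law, jointly measurable shift-covariant observables `A_i` of (configuration, base point) dominated
by the moment functional, and a smooth scalar `ψ`, `E ∫_x Σ_i A_i(·, x) ∂_iψ(x) dx = 0`: after Fubini the
means `E A_i(·, x)` do not depend on `x` (translation invariance, `integral_translate_eq`) and
`∫_{𝕋³} ∂_iψ = 0`. [folklore] -/
theorem integral_covariantVectorPairing_eq_zero {σ : ℝ} (hσ : σ ≤ 1 / 2) {a θ : ℝ} (ha : 0 < a)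
    (hθ : 0 < θ) (u : V3) {N : ℕ} (Φ : HardSphereFlow (Torus.geometry (Fin 3)) (hsDiameter σ N) (N + 1))
    {ψ : T3 → ℝ} (hψ : Torus.IsSmooth ψ) (A : Fin 3 → Config (N + 1) (Fin 3) T3 → T3 → ℝ)
    (hAm : ∀ i, Measurable fun p : Config (N + 1) (Fin 3) T3 × T3 => A i p.1 p.2) {K : ℝ}
    (hAle : ∀ i w x, |A i w x| ≤ K * ((∑ b, ‖(w b).2‖ ^ 2) + (∑ b, ‖(w b).2‖ ^ 2) ^ 2))
    (hAcov : ∀ i w x, A i w x = A i (fun l => ((w l).1 + -x, (w l).2)) 0) :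
    ∫ w, (∫ x, ∑ i, A i w x * Torus.partialDeriv i ψ x)
      ∂(localGibbsLaw σ (fun _ => a) (fun _ => u) (fun _ => θ) N Φ) = 0 := by
  set μ := localGibbsLaw σ (fun _ => a) (fun _ => u) (fun _ => θ) N Φ with hμ
  obtain ⟨C, -, hC⟩ := exists_forall_abs_partialDeriv_le_scalar hψ
  have hP : ∀ i, Continuous (Torus.partialDeriv i ψ) := fun i => (hψ.partialDeriv i).continuous
  -- the integrand, jointly measurable and dominated by the moment functional
  set F : Config (N + 1) (Fin 3) T3 → T3 → ℝ := fun w x => ∑ i, A i w x * Torus.partialDeriv i ψ x with hF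
  have hFm : Measurable fun p : Config (N + 1) (Fin 3) T3 × T3 => F p.1 p.2 := by
    simp only [hF]
    exact Finset.measurable_sum _ fun i _ => (hAm i).mul ((hP i).measurable.comp measurable_snd)
  have hFle : ∀ w x, |F w x| ≤ 3 * K * C * ((∑ b, ‖(w b).2‖ ^ 2) + (∑ b, ‖(w b).2‖ ^ 2) ^ 2) := by
    intro w x
    simp only [hF]
    calc |∑ i, A i w x * Torus.partialDeriv i ψ x|
        ≤ ∑ _i : Fin 3, K * ((∑ b, ‖(w b).2‖ ^ 2) + (∑ b, ‖(w b).2‖ ^ 2) ^ 2) * C :=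
          (Finset.abs_sum_le_sum_abs _ _).trans (Finset.sum_le_sum fun i _ => by
            rw [abs_mul]
            exact mul_le_mul (hAle i w x) (hC i x) (abs_nonneg _) ((abs_nonneg _).trans (hAle i w x)))
      _ = 3 * K * C * ((∑ b, ‖(w b).2‖ ^ 2) + (∑ b, ‖(w b).2‖ ^ 2) ^ 2) := by
          simp only [Finset.sum_const, Finset.card_univ, Fintype.card_fin]
          ring
  obtain ⟨-, hswap⟩ := integral_integral_swap_of_le_moment hσ continuous_const continuous_const
    continuous_const (fun _ => ha) (fun _ => hθ) Φ F hFm hFle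
  have hAint : ∀ i x, Integrable (fun w => A i w x) μ := fun i =>
    (integral_integral_swap_of_le_moment hσ continuous_const continuous_const continuous_const
      (fun _ => ha) (fun _ => hθ) Φ (A i) (hAm i) (hAle i)).1
  -- translation invariance: the means at base point `x` are the means at `0`
  have hAx : ∀ i x, ∫ w, A i w x ∂μ = ∫ w, A i w 0 ∂μ := fun i x =>
    integral_translate_eq u Φ (A i) (hAcov i) ((hAm i).comp (measurable_id.prodMk measurable_const)) x
  have hinner : ∀ x, ∫ w, F w x ∂μ = ∑ i, (∫ w, A i w 0 ∂μ) * Torus.partialDeriv i ψ x := by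
    intro x
    simp only [hF]
    rw [integral_finsetSum _ fun i _ => (hAint i x).mul_const _]
    exact Finset.sum_congr rfl fun i _ => by rw [integral_mul_const, hAx i x]
  change ∫ w, (∫ x, F w x) ∂μ = 0
  rw [hswap, ← hμ]
  simp_rw [hinner]
  have hIi : ∀ i, Integrable (fun x => (∫ w, A i w 0 ∂μ) * Torus.partialDeriv i ψ x) volume :=
    fun i => (integrable_of_continuous_T3 (hP i)).const_mul _
  rw [integral_finsetSum _ fun i _ => hIi i]
  refine Finset.sum_eq_zero fun i _ => ?_
  rw [integral_const_mul, Torus.integral_partialDeriv_eq_zero_holds hψ i, mul_zero]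

/-- Averages over the particles of a constant are at most the constant: `n⁻¹ Σ_a B ≤ B` (`B ≥ 0`). [folklore] -/
theorem avg_const_le {n : ℕ} {B : ℝ} (hB : 0 ≤ B) : (n : ℝ)⁻¹ * ∑ _a : Fin n, B ≤ B := by
  simp only [Finset.sum_const, Finset.card_univ, Fintype.card_fin, nsmul_eq_mul, ← mul_assoc]
  exact mul_le_of_le_one_left hB inv_mul_le_one

/-- **The mollified energy-current observable has mean zero at equilibrium**:
`E ∫_x n⁻¹Σ_a k(x−x_a)(v_a·∇ψ(x))‖v_a‖²/2 dx = 0` (covariant vector pairing with `∇ψ`,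
`A_i = n⁻¹Σ_a k(x−x_a) v_a^i ‖v_a‖²/2`, `|A_i| ≤ sup|k| · M/4`). [folklore] -/
theorem integral_currentObservable_eq_zero_const {σ : ℝ} (hσ : σ ≤ 1 / 2) {a θ : ℝ} (ha : 0 < a)
    (hθ : 0 < θ) (u : V3) {N : ℕ} (Φ : HardSphereFlow (Torus.geometry (Fin 3)) (hsDiameter σ N) (N + 1))
    {ψ : T3 → ℝ} (hψ : Torus.IsSmooth ψ) {k : T3 → ℝ} (hkc : Continuous k) :
    ∫ w, (∫ x, ((N + 1 : ℕ) : ℝ)⁻¹ * ∑ a, k (x - (w a).1) *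
        ((∑ i, (w a).2 i * Torus.partialDeriv i ψ x) * (‖(w a).2‖ ^ 2 / 2)))
      ∂(localGibbsLaw σ (fun _ => a) (fun _ => u) (fun _ => θ) N Φ) = 0 := by
  obtain ⟨Kk, hKk0, hKk⟩ := exists_forall_abs_le_of_continuous hkc
  haveI : OpensMeasurableSpace (Config (N + 1) (Fin 3) T3 × T3) := Prod.opensMeasurableSpace
  set c : ℝ := ((N + 1 : ℕ) : ℝ)⁻¹ with hc
  have hc0 : 0 ≤ c := inv_nonneg.2 (Nat.cast_nonneg _)
  have h := integral_covariantVectorPairing_eq_zero hσ ha hθ u Φ hψ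
    (fun i w x => (c * ∑ a, k (x - (w a).1) * ((w a).2 i * ‖(w a).2‖ ^ 2)) / 2)
    (fun i => Continuous.measurable (by fun_prop)) (K := Kk / 4)
    (fun i w x => by
      set M : ℝ := (∑ b, ‖(w b).2‖ ^ 2) + (∑ b, ‖(w b).2‖ ^ 2) ^ 2 with hM
      have hM0 : 0 ≤ M := by positivity
      rw [abs_div, abs_two, abs_mul, abs_of_nonneg hc0]
      have hvi : ∀ a, |(w a).2 i| ≤ ‖(w a).2‖ := fun a =>
        (Real.norm_eq_abs _).symm.trans_le (PiLp.norm_apply_le _ i)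
      calc c * |∑ a, k (x - (w a).1) * ((w a).2 i * ‖(w a).2‖ ^ 2)| / 2
          ≤ c * (∑ _a : Fin (N + 1), Kk * (M / 2)) / 2 := by
            refine div_le_div_of_nonneg_right (mul_le_mul_of_nonneg_left ((Finset.abs_sum_le_sum_abs _ _).trans
              (Finset.sum_le_sum fun a _ => ?_)) hc0) zero_le_two
            rw [abs_mul, abs_mul, abs_of_nonneg (sq_nonneg ‖(w a).2‖)]
            refine mul_le_mul (hKk _) ?_ (by positivity) hKk0
            calc |(w a).2 i| * ‖(w a).2‖ ^ 2 ≤ ‖(w a).2‖ * ‖(w a).2‖ ^ 2 :=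
                  mul_le_mul_of_nonneg_right (hvi a) (sq_nonneg _)
              _ = ‖(w a).2‖ ^ 3 := by ring
              _ ≤ M / 2 := (norm_pow_three_le_and_energy_mul_norm_le w a).1
        _ ≤ Kk * (M / 2) / 2 := div_le_div_of_nonneg_right (avg_const_le (by positivity)) zero_le_two
        _ = Kk / 4 * M := by ring)
    (fun i w x => by
      dsimp only
      congr 1
      congr 1
      exact Finset.sum_congr rfl fun a _ => by rw [show (0 : T3) - ((w a).1 + -x) = x - (w a).1 by abel])
  refine Eq.trans (integral_congr_ae (ae_of_all _ fun w => integral_congr_ae (ae_of_all _ fun x => ?_))) h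
  exact avg_current_eq_sum (fun a => k (x - (w a).1)) (fun a => (w a).2) c (fun i => Torus.partialDeriv i ψ x)

/-- **The ideal enthalpy-flux observable has mean zero at equilibrium**: `E ∫_x ((En + RΘ)/R)(Mv·∇ψ) dx = 0`
(covariant vector pairing with `∇ψ`, `A_i = ((En + RΘ)/R) Mv_i`: the mollified fields are shift covariant,
`fields_translate`; domination `|A_i| ≤ (5/6)(Σ_b‖v_b‖²) sup|k| n⁻¹Σ_a‖v_a‖ ≤ (5/12) sup|k| M`). [folklore] -/
theorem integral_idealCurrentObservable_eq_zero_const {σ : ℝ} (hσ : σ ≤ 1 / 2) {a θ : ℝ} (ha : 0 < a)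
    (hθ : 0 < θ) (u : V3) {N : ℕ} (Φ : HardSphereFlow (Torus.geometry (Fin 3)) (hsDiameter σ N) (N + 1))
    {ψ : T3 → ℝ} (hψ : Torus.IsSmooth ψ) {k : T3 → ℝ} (hkc : Continuous k) (hk0 : ∀ y, 0 ≤ k y) :
    ∫ w, (∫ x, (empiricalEnergyField w (fun y => k (x - y)) + empiricalDensityField w (fun y => k (x - y)) *
          (2 / 3 * (empiricalEnergyField w (fun y => k (x - y)) / empiricalDensityField w (fun y => k (x - y)) -
            ‖empiricalMomentumField w (fun y => k (x - y))‖ ^ 2 / (2 * empiricalDensityField w (fun y => k (x - y)) ^ 2)))) /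
          empiricalDensityField w (fun y => k (x - y)) *
        (∑ i, empiricalMomentumField w (fun y => k (x - y)) i * Torus.partialDeriv i ψ x))
      ∂(localGibbsLaw σ (fun _ => a) (fun _ => u) (fun _ => θ) N Φ) = 0 := by
  obtain ⟨Kk, hKk0, hKk⟩ := exists_forall_abs_le_of_continuous hkc
  haveI : OpensMeasurableSpace (Config (N + 1) (Fin 3) T3 × T3) := Prod.opensMeasurableSpace
  have mR := (continuous_density_prod (n := N + 1) hkc).measurable
  have hMv := continuous_momentum_prod (n := N + 1) hkc
  have mMv : ∀ l, Measurable fun p : Config (N + 1) (Fin 3) T3 × T3 => empiricalMomentumField p.1 (fun y => k (p.2 - y)) l :=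
    fun l => ((PiLp.continuous_apply 2 _ l).comp hMv).measurable
  have mN := (continuous_norm.comp hMv).measurable
  have mEn := (continuous_energy_prod (n := N + 1) hkc).measurable
  set c : ℝ := ((N + 1 : ℕ) : ℝ)⁻¹ with hc
  have hc0 : 0 ≤ c := inv_nonneg.2 (Nat.cast_nonneg _)
  -- domination of `A_i = ((En + RΘ)/R) Mv_i`
  have hdom : ∀ (i : Fin 3) (w : Config (N + 1) (Fin 3) T3) (x : T3),
      |(empiricalEnergyField w (fun y => k (x - y)) + empiricalDensityField w (fun y => k (x - y)) *
          (2 / 3 * (empiricalEnergyField w (fun y => k (x - y)) / empiricalDensityField w (fun y => k (x - y)) -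
            ‖empiricalMomentumField w (fun y => k (x - y))‖ ^ 2 / (2 * empiricalDensityField w (fun y => k (x - y)) ^ 2)))) /
          empiricalDensityField w (fun y => k (x - y)) * empiricalMomentumField w (fun y => k (x - y)) i| ≤
        5 / 12 * Kk * ((∑ b, ‖(w b).2‖ ^ 2) + (∑ b, ‖(w b).2‖ ^ 2) ^ 2) := by
    intro i w x
    set R : ℝ := empiricalDensityField w (fun y => k (x - y)) with hR
    set Mv : V3 := empiricalMomentumField w (fun y => k (x - y)) with hMv'
    set En : ℝ := empiricalEnergyField w (fun y => k (x - y)) with hEn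
    set E : ℝ := ∑ b, ‖(w b).2‖ ^ 2 with hE
    set M : ℝ := E + E ^ 2 with hM
    obtain ⟨hR0, hEn0, -, hP⟩ := abs_reynolds_le_and_abs_pressure_le w x hk0 hR hMv' hEn
    have hE0 : 0 ≤ E := Finset.sum_nonneg fun b _ => sq_nonneg _
    have hER := energy_div_density_le w x hk0 hR hEn
    have h1 : |(En + R * (2 / 3 * (En / R - ‖Mv‖ ^ 2 / (2 * R ^ 2)))) / R| ≤ 5 / 3 * (E / 2) := by
      rw [abs_div, abs_of_nonneg hR0]
      have h : |En + R * (2 / 3 * (En / R - ‖Mv‖ ^ 2 / (2 * R ^ 2)))| ≤ 5 / 3 * En := by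
        refine (abs_add_le _ _).trans ?_
        rw [abs_of_nonneg hEn0]
        linarith
      calc _ ≤ 5 / 3 * En / R := div_le_div_of_nonneg_right h hR0
        _ = 5 / 3 * (En / R) := by ring
        _ ≤ 5 / 3 * (E / 2) := by linarith
    have h2 : |Mv i| ≤ c * ∑ a, k (x - (w a).1) * ‖(w a).2‖ :=
      ((Real.norm_eq_abs _).symm.trans_le (PiLp.norm_apply_le Mv i)).trans (norm_mollifiedMomentum_le w x hk0 hMv')
    have h3 : E * (c * ∑ a, k (x - (w a).1) * ‖(w a).2‖) ≤ Kk * (M / 2) := by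
      rw [mul_left_comm, Finset.mul_sum]
      calc c * ∑ a, E * (k (x - (w a).1) * ‖(w a).2‖) ≤ c * ∑ _a : Fin (N + 1), Kk * (M / 2) := by
            refine mul_le_mul_of_nonneg_left (Finset.sum_le_sum fun a _ => ?_) hc0
            calc E * (k (x - (w a).1) * ‖(w a).2‖) = k (x - (w a).1) * (E * ‖(w a).2‖) := by ring
              _ ≤ Kk * (M / 2) := mul_le_mul ((le_abs_self _).trans (hKk _))
                  (norm_pow_three_le_and_energy_mul_norm_le w a).2 (by positivity) hKk0
        _ ≤ Kk * (M / 2) := avg_const_le (by positivity)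
    rw [abs_mul]
    calc |(En + R * (2 / 3 * (En / R - ‖Mv‖ ^ 2 / (2 * R ^ 2)))) / R| * |Mv i|
        ≤ 5 / 3 * (E / 2) * (c * ∑ a, k (x - (w a).1) * ‖(w a).2‖) := mul_le_mul h1 h2 (abs_nonneg _) (by positivity)
      _ = 5 / 6 * (E * (c * ∑ a, k (x - (w a).1) * ‖(w a).2‖)) := by ring
      _ ≤ 5 / 6 * (Kk * (M / 2)) := mul_le_mul_of_nonneg_left h3 (by norm_num)
      _ = 5 / 12 * Kk * M := by ring
  have h := integral_covariantVectorPairing_eq_zero hσ ha hθ u Φ hψ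
    (fun i w x => (empiricalEnergyField w (fun y => k (x - y)) + empiricalDensityField w (fun y => k (x - y)) *
          (2 / 3 * (empiricalEnergyField w (fun y => k (x - y)) / empiricalDensityField w (fun y => k (x - y)) -
            ‖empiricalMomentumField w (fun y => k (x - y))‖ ^ 2 / (2 * empiricalDensityField w (fun y => k (x - y)) ^ 2)))) /
          empiricalDensityField w (fun y => k (x - y)) * empiricalMomentumField w (fun y => k (x - y)) i)
    (fun i => ((mEn.add (mR.mul (measurable_const.mul ((mEn.div mR).sub ((mN.pow_const 2).div
      (measurable_const.mul (mR.pow_const 2))))))).div mR).mul (mMv i)) hdom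
    (fun i w x => by
      obtain ⟨h1, h2, h3⟩ := fields_translate w x k
      rw [h1, h2, h3])
  refine Eq.trans (integral_congr_ae (ae_of_all _ fun w => integral_congr_ae (ae_of_all _ fun x => ?_))) h
  dsimp only
  rw [Finset.mul_sum]
  exact Finset.sum_congr rfl fun i _ => by ring

end IdealEnergyCurrentClosure

open IdealEnergyCurrentClosure DeviatoricStressClosure in
/-- **Registered sub-goal `stub_idealEnergyCurrentClosure_equilibrium` of stub KE-b: at equilibrium the
stub's functional has mean exactly zero, for every `N`.** For CONSTANT profiles `a₀ ≡ a > 0`, `u₀ ≡ u`,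
`θ₀ ≡ θ > 0` and `σ ≤ 1/2`, every hard-sphere flow, every window `t₁ ≤ t₂`, every smooth scalar `ψ` and
every continuous probability kernel `k ≥ 0`, the stub's functional `D` (as in `stub_idealEnergyCurrentClosure`
with `Φ` for `Φ N`) satisfies `∫ D ∂(localGibbsLaw σ a u θ N Φ) = 0`: by time Fubini and flow invariance
(`integral_window_flow_eq_const_moment`) `E D = (t₂ − t₁)(E T^e − E J^e)`, and both the mollified energy
current observable `T^e` and the ideal enthalpy-flux observable `J^e` have mean zero by translation
invariance and `∫_{𝕋³} ∂_iψ = 0` (`integral_currentObservable_eq_zero_const`,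
`integral_idealCurrentObservable_eq_zero_const`). [folklore] -/
theorem stub_idealEnergyCurrentClosure_equilibrium : ∀ (σ : ℝ), σ ≤ 1 / 2 → ∀ (a θ : ℝ), 0 < a → 0 < θ → ∀ (u : Literature.MathematicalPhysics.KineticTheory.V3) (N : ℕ) (Φ : Literature.Analysis.FluidPDE.HardSphereFlow (Literature.Analysis.FluidPDE.Torus.geometry (Fin 3)) (Literature.MathematicalPhysics.KineticTheory.hsDiameter σ N) (N + 1)) (t₁ t₂ : ℝ), t₁ ≤ t₂ → ∀ (ψ : Literature.MathematicalPhysics.KineticTheory.T3 → ℝ), Literature.Analysis.FunctionSpaces.Torus.IsSmooth ψ → ∀ (k : Literature.MathematicalPhysics.KineticTheory.T3 → ℝ), Continuous k → (∀ y, 0 ≤ k y) → (∫ y, k y = 1) → ∀ D : Literature.Analysis.FluidPDE.Config (N + 1) (Fin 3) Literature.MathematicalPhysics.KineticTheory.T3 → ℝ, D = (fun z => (∫ s in t₁..t₂, ∫ x, ((N + 1 : ℕ) : ℝ)⁻¹ * ∑ a, k (x - (Φ.flow s z a).1) * ((∑ i, (Φ.flow s z a).2 i * Literature.Analysis.FunctionSpaces.Torus.partialDeriv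 i ψ x) * (‖(Φ.flow s z a).2‖ ^ 2 / 2))) - (∫ s in t₁..t₂, ∫ x, (((Literature.MathematicalPhysics.KineticTheory.empiricalEnergyField (Φ.flow s z) (fun y => k (x - y)) + Literature.MathematicalPhysics.KineticTheory.empiricalDensityField (Φ.flow s z) (fun y => k (x - y)) * (2 / 3 * (Literature.MathematicalPhysics.KineticTheory.empiricalEnergyField (Φ.flow s z) (fun y => k (x - y)) / Literature.MathematicalPhysics.KineticTheory.empiricalDensityField (Φ.flow s z) (fun y => k (x - y)) - ‖Literature.MathematicalPhysics.KineticTheory.empiricalMomentumField (Φ.flow s z) (fun y => k (x - y))‖ ^ 2 / (2 * Literature.MathematicalPhysics.KineticTheory.empiricalDensityField (Φ.flow s z) (fun y => k (x - y)) ^ 2)))) / Literature.MathematicalPhysics.KineticTheory.empiricalDensityField (Φ.flow s z) (fun y => k (x - y))) * (∑ i, Literature.MathematicalPhysics.KineticTheory.empiricalMomentumField (Φ.flow s z) (fun y => k (x - y)) i * Literature.Analysis.FunctionSpaces.Torus.partialDeriv i ψ x)))) → ∫ z, D z ∂Literature.MathematicalPhysics.KineticTheory.localGibbsLaw σ (fun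 _ => a) (fun _ => u) (fun _ => θ) N Φ = 0 := by
  intro σ hσ a θ ha hθ u N Φ t₁ t₂ h₁₂ ψ hψ k hkc hk0 hk1 D hD
  set μ := localGibbsLaw σ (fun _ => a) (fun _ => u) (fun _ => θ) N Φ with hμ
  obtain ⟨C, -, hC⟩ := exists_forall_abs_partialDeriv_le_scalar hψ
  -- the two observables
  set T : Config (N + 1) (Fin 3) T3 → ℝ := fun w => ∫ x, ((N + 1 : ℕ) : ℝ)⁻¹ * ∑ a, k (x - (w a).1) *
    ((∑ i, (w a).2 i * Torus.partialDeriv i ψ x) * (‖(w a).2‖ ^ 2 / 2)) with hT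
  set J : Config (N + 1) (Fin 3) T3 → ℝ := fun w => ∫ x,
    (empiricalEnergyField w (fun y => k (x - y)) + empiricalDensityField w (fun y => k (x - y)) *
        (2 / 3 * (empiricalEnergyField w (fun y => k (x - y)) / empiricalDensityField w (fun y => k (x - y)) -
          ‖empiricalMomentumField w (fun y => k (x - y))‖ ^ 2 / (2 * empiricalDensityField w (fun y => k (x - y)) ^ 2)))) /
        empiricalDensityField w (fun y => k (x - y)) *
      (∑ i, empiricalMomentumField w (fun y => k (x - y)) i * Torus.partialDeriv i ψ x) with hJ
  have hTm : Measurable T := measurable_currentObservable hkc hψ _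
  have hJm : Measurable J := measurable_idealCurrentObservable hkc hψ
  have hTle : ∀ w, |T w| ≤ 3 / 4 * C * ((∑ b, ‖(w b).2‖ ^ 2) + (∑ b, ‖(w b).2‖ ^ 2) ^ 2) :=
    fun w => abs_integral_currentIntegrand_le w hkc hk0 hk1 hC
  have hJle : ∀ w, |J w| ≤ 5 / 4 * C * ((∑ b, ‖(w b).2‖ ^ 2) + (∑ b, ‖(w b).2‖ ^ 2) ^ 2) :=
    fun w => abs_integral_idealCurrentIntegrand_le w hkc hk0 hk1 hC
  have hWTi : Integrable (fun z => ∫ s in t₁..t₂, T (Φ.flow s z)) μ :=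
    integrable_window_flow_moment hσ continuous_const continuous_const continuous_const (fun _ => ha)
      (fun _ => hθ) Φ hTm hTle t₁ t₂
  have hWJi : Integrable (fun z => ∫ s in t₁..t₂, J (Φ.flow s z)) μ :=
    integrable_window_flow_moment hσ continuous_const continuous_const continuous_const (fun _ => ha)
      (fun _ => hθ) Φ hJm hJle t₁ t₂
  have hD' : D = fun z => (∫ s in t₁..t₂, T (Φ.flow s z)) - ∫ s in t₁..t₂, J (Φ.flow s z) := hD
  rw [hD', integral_sub hWTi hWJi, integral_window_flow_eq_const_moment hσ ha hθ u Φ hTm hTle h₁₂,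
    integral_window_flow_eq_const_moment hσ ha hθ u Φ hJm hJle h₁₂, hT, hJ,
    integral_currentObservable_eq_zero_const hσ ha hθ u Φ hψ hkc,
    integral_idealCurrentObservable_eq_zero_const hσ ha hθ u Φ hψ hkc hk0, mul_zero, sub_zero]

end Summit.AtomisticToContinuum.HydrodynamicLimit.Theorems

end
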